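import Summits.QuantumFields.BalabanUV.Beta.GAN24.DirichletVertexLocal

/-!
# `BalabanUV.Beta.GAN24.DirichletVertexPiece` — binder row G-an2-4 / (CONV-C), road P2 PART IV, leaf L14 (the torus transfer), FILE C3:
# THE UNWEIGHTED HESSIAN ON AN ISOLATED QUADRANT PIECE (the two halves of a CHECKERBOARD vertex), ON THE TORUS, `d = 2`
# (unit b2b-balaban-gan24-p2, gen 26, v1)

HONEST FRAMING (cell contract, verbatim): «discharging `BetaPertH` makes Bałaban's UV stability UNCONDITIONAL — a real constructive-QFT
result; it is NOT the continuum limit and NOT the Clay problem.»  SUPPLIER module under the T⁴-DAG sub-row `T4-U1a.S-NE2-D1-DIRICHLET°`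
(owner wording R24 «the full rate L⁻¹ beyond boxes OPEN»).  At a CHECKERBOARD vertex (two diagonal blocks of the star in `S`, the other
two not) the pulled-back region is not axis-separated and the torus-level local `H²` identity has an uncontrolled exterior cross term at the
two tips.  REPAIR (memo `gen26/L14-TRANSFER.md` §3): each block `Q(a,y)` of the star that lies in `S` while its two ADJACENT star blocks do
not is an ISOLATED QUADRANT PIECE — the lattice neighbours of its sites lie in the piece or in blocks where `u = 0` — so the masked pull-back
`Um = 𝟙_{Q(a,y)}·Up u` has the same second differences and Laplacian as `Up u` on the piece, is supported in the quadrant `Q(a,y)` (a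
product region, axis-separated), and `DirichletRingHessianLocalShift.local_hessian_le_shift` applies to it.  A checkerboard vertex is the
sum of its two pieces; a convex corner is one piece (also covered by `DirichletVertexLocal`).

## Contents ([folklore]; 0 sorry)
* §1 the quadrant `Quad a y = Wprod (· = a) (· = y)`, the mask `Um`, `IsolatedAt S σ b a y` ([shape]: the piece block is in `S`, its two
  adjacent star blocks are not); on the window: `Up u = 0` on the adjacent blocks, `d1/d2/lap (Up u) = d1/d2/lap (Um u)` at piece sites,
  `hb/vb (Um u) ≤ hb/vb (Up u)`, `‖Um‖ ≤ ‖Up‖`.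
* §2 **`piece_local_hessian_le`**: `Σ_{Q_{2L+c−1}} 𝟙_{Q(a,y)}(|d1 Up u|²+|d2 Up u|²) ≤ 2B/n⁴ + (32/L²)E/n² + (16/L⁴)·nsq u`
  (`1 ≤ L`, `4L+c+3 ≤ n`, `2 ≤ M_ν`).
* §3 push-forward `pieceW` and **`piece_hessian_solExt_le`**: `Σ_μ Σ_x pieceW(x)|(∂ᴴ_μ∂_μ u_f)(x)|² ≤ (4(1+(a′γ′⁻¹)²) + 32(n/L)²γ′⁻¹ +
  16(n/L)⁴γ′⁻²)·‖f‖²`.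

ABSOLUTE RULE (cell, verbatim): «No internally-minted statement may enter as a cited fact. Every hypothesis is either kernel-proved in
this package or a verbatim quotation of a PUBLISHED theorem with page reference. The manuscript(s) under audit are NOT citable for
their own disputed steps — they are the thing under adjudication; programme-internal (2001/route/tribunal) claims are never citable.»
Nothing printed is a hypothesis.  NOT CLAIMED: the coverage, `ω ≤ w′`, (Φ)/(Φ′), the END; NOT NE2, (CONV-C), `BetaPertH`, continuum, Clay.
«not in print; our proof attempt».  HONEST DEPENDENCY: continuum YM on T⁴ ⇐ BetaPertH ∧ nine spine estimates (0/9 proved); BetaPertH ⇐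
(D1) ∧ (D4) ∧ CAP+tail; G-an2-4 gates asym, D1 and NE2/3/4.
-/

noncomputable section

open scoped BigOperators ComplexConjugate Matrix
open Finset

namespace Summit.QuantumFields.BalabanUV.Beta.GAN24.DirichletVertexPiece

open Literature.MathematicalPhysics.QuantumFieldTheory.Balaban1983to89.B5Prop11Plancherel (Tor fine unitVec)
open Literature.MathematicalPhysics.QuantumFieldTheory.Balaban1983to89.B5Action121 (sdiff LapS)
open Literature.MathematicalPhysics.QuantumFieldTheory.Balaban1983to89.B5Prop11Lower (nsq nsq_nonneg)
open Summit.QuantumFields.BalabanUV.T4Continuum.ScalarAveragedPropagator (gammaPs gammaPs_pos dirichlet)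
open Summit.QuantumFields.BalabanUV.Beta.GAN24.DirichletBoxRegularity (Pdir)
open Summit.QuantumFields.BalabanUV.Beta.GAN24.DirichletBoxTrace (blockReg)
open Summit.QuantumFields.BalabanUV.Beta.GAN24.DirichletBoxCompression (solExt solExt_apply_of_not dirichlet_solExt_le
  sum_normSq_LapS_solExt_le nsq_solExt_le)
open DirichletRingEnergies (hb vb lap Et sqSum Et_nonneg sqSum_nonneg hb_nonneg vb_nonneg)
open DirichletRingCutoff (tIdx one_le_tIdx)
open DirichletRingHessianIdentity (d1 d2)
open DirichletRingHessianLocal (AxisSep indW indW_mem)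
open DirichletRingHessianLocalShift (local_hessian_le_shift)
open DirichletVertexChart
open DirichletVertexPullback
open DirichletVertexLocal (Wprod axisSep_Wprod blockReg_emb_iff sgnPat_apply sqSum_normSq_Up_le)

variable (n : ℕ) [NeZero n] (M : Fin 2 → ℕ) [hM : ∀ μ, NeZero (M μ)]

/-! ## §1 The quadrant piece and its mask -/

/-- the model quadrant with sign pattern `(a, y)`: `Quad a y (i,j) ↔ (0 ≤ i) = a ∧ (0 ≤ j) = y`. [folklore] -/
abbrev Quad (a y : Bool) : ℤ → ℤ → Prop := Wprod (fun s => s = a) (fun s => s = y)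

/-- the MASKED PULL-BACK on the piece: `Um u = 𝟙_{Quad a y}·Up u`. [folklore] -/
def Um (σ : Fin 2 → Bool) (b : Tor M) (a y : Bool) (u : Tor (fine n M) → ℂ) (i j : ℤ) : ℂ :=
  if Quad a y i j then Up n M σ b u i j else 0

/-- [shape] **ISOLATED QUADRANT PIECE** at `(σ, b)` with signs `(a, y)`: the star block `(a, y)` is in `S`, the two ADJACENT star blocks
`(¬a, y)` and `(a, ¬y)` are not (a checkerboard vertex has two such pieces, a convex corner one). [folklore] -/
def IsolatedAt (S : Tor M → Prop) (σ : Fin 2 → Bool) (b : Tor M) (a y : Bool) : Prop :=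
  (∀ p : Fin 2 → Bool, p 0 = a → p 1 = y → S (starBlk M σ b p))
    ∧ (∀ p : Fin 2 → Bool, p 0 ≠ a → p 1 = y → ¬ S (starBlk M σ b p))
    ∧ (∀ p : Fin 2 → Bool, p 0 = a → p 1 ≠ y → ¬ S (starBlk M σ b p))

section Piece

variable {S : Tor M → Prop} {σ : Fin 2 → Bool} {b : Tor M} {a y : Bool} {u : Tor (fine n M) → ℂ}

omit hM in
/-- membership in the quadrant in terms of signs. [folklore] -/
theorem quad_iff (i j : ℤ) : Quad a y i j ↔ (decide (0 ≤ i) = a ∧ decide (0 ≤ j) = y) := Iff.rfl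

/-- piece sites of the window are in `Ω`. [folklore] -/
theorem blockReg_of_quad (hI : IsolatedAt M S σ b a y) {i j : ℤ} (hi : -(n : ℤ) ≤ i) (hi' : i < n) (hj : -(n : ℤ) ≤ j) (hj' : j < n)
    (hq : Quad a y i j) : blockReg n M S (emb n M σ b i j) := by
  rw [blockReg_emb_iff n M hi hi' hj hj']
  exact hI.1 _ (by rw [(sgnPat_apply i j).1]; exact hq.1) (by rw [(sgnPat_apply i j).2]; exact hq.2)

/-- on the two adjacent blocks of the window the pull-back vanishes: if the first sign differs and the second agrees … [folklore] -/
theorem Up_eq_zero_adj₁ (hu : ∀ x, ¬ blockReg n M S x → u x = 0) (hI : IsolatedAt M S σ b a y) {i j : ℤ}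
    (hi : -(n : ℤ) ≤ i) (hi' : i < n) (hj : -(n : ℤ) ≤ j) (hj' : j < n) (h1 : decide (0 ≤ i) ≠ a) (h2 : decide (0 ≤ j) = y) :
    Up n M σ b u i j = 0 := by
  refine hu _ fun h => ?_
  rw [blockReg_emb_iff n M hi hi' hj hj'] at h
  exact hI.2.1 _ (by rw [(sgnPat_apply i j).1]; exact h1) (by rw [(sgnPat_apply i j).2]; exact h2) h

/-- … or the first agrees and the second differs. [folklore] -/
theorem Up_eq_zero_adj₂ (hu : ∀ x, ¬ blockReg n M S x → u x = 0) (hI : IsolatedAt M S σ b a y) {i j : ℤ}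
    (hi : -(n : ℤ) ≤ i) (hi' : i < n) (hj : -(n : ℤ) ≤ j) (hj' : j < n) (h1 : decide (0 ≤ i) = a) (h2 : decide (0 ≤ j) ≠ y) :
    Up n M σ b u i j = 0 := by
  refine hu _ fun h => ?_
  rw [blockReg_emb_iff n M hi hi' hj hj'] at h
  exact hI.2.2 _ (by rw [(sgnPat_apply i j).1]; exact h1) (by rw [(sgnPat_apply i j).2]; exact h2) h

/-- **the mask is invisible along the first axis**: for a piece site `(i, j)` of the window, `Um u (i±1, j) = Up u (i±1, j)`. [folklore] -/
theorem Um_nbr_fst (hu : ∀ x, ¬ blockReg n M S x → u x = 0) (hI : IsolatedAt M S σ b a y) {i j : ℤ}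
    (hi : -(n : ℤ) + 1 ≤ i) (hi' : i + 1 < n) (hj : -(n : ℤ) ≤ j) (hj' : j < n) (hq : Quad a y i j) (d : ℤ) (hd : d = 1 ∨ d = -1) :
    Um n M σ b a y u (i + d) j = Up n M σ b u (i + d) j := by
  rw [Um]
  split_ifs with h
  · rfl
  · -- the neighbour is not in the piece: its first sign differs, its second agrees ⇒ `Up = 0` there
    rw [quad_iff] at h hq
    have h2 : decide (0 ≤ j) = y := hq.2
    have h1 : decide (0 ≤ i + d) ≠ a := fun h1 => h ⟨h1, h2⟩
    exact (Up_eq_zero_adj₁ n M hu hI (by omega) (by omega) hj hj' h1 h2).symm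

/-- the mask is invisible along the second axis. [folklore] -/
theorem Um_nbr_snd (hu : ∀ x, ¬ blockReg n M S x → u x = 0) (hI : IsolatedAt M S σ b a y) {i j : ℤ}
    (hi : -(n : ℤ) ≤ i) (hi' : i < n) (hj : -(n : ℤ) + 1 ≤ j) (hj' : j + 1 < n) (hq : Quad a y i j) (d : ℤ) (hd : d = 1 ∨ d = -1) :
    Um n M σ b a y u i (j + d) = Up n M σ b u i (j + d) := by
  rw [Um]
  split_ifs with h
  · rfl
  · rw [quad_iff] at h hq
    have h1 : decide (0 ≤ i) = a := hq.1
    have h2 : decide (0 ≤ j + d) ≠ y := fun h2 => h ⟨h1, h2⟩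
    exact (Up_eq_zero_adj₂ n M hu hI hi hi' (by omega) (by omega) h1 h2).symm

omit [NeZero n] hM in
/-- at a piece site the mask is invisible. [folklore] -/
theorem Um_self {i j : ℤ} (hq : Quad a y i j) : Um n M σ b a y u i j = Up n M σ b u i j := by rw [Um, if_pos hq]

omit [NeZero n] hM in
/-- off the piece the mask kills the field. [folklore] -/
theorem Um_of_not {i j : ℤ} (hq : ¬ Quad a y i j) : Um n M σ b a y u i j = 0 := by rw [Um, if_neg hq]

/-- **second differences and Laplacian of the masked field equal those of the pull-back at piece sites** of the window `[−n+1, n−1)²`.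
[folklore] -/
theorem hess_Um_eq (hu : ∀ x, ¬ blockReg n M S x → u x = 0) (hI : IsolatedAt M S σ b a y) {i j : ℤ}
    (hi : -(n : ℤ) + 1 ≤ i) (hi' : i + 1 < n) (hj : -(n : ℤ) + 1 ≤ j) (hj' : j + 1 < n) (hq : Quad a y i j) :
    d1 (Um n M σ b a y u) i j = d1 (Up n M σ b u) i j ∧ d2 (Um n M σ b a y u) i j = d2 (Up n M σ b u) i j
      ∧ lap (Um n M σ b a y u) i j = lap (Up n M σ b u) i j := by
  have h0 := Um_self n M (σ := σ) (b := b) (u := u) hq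
  have h1 := Um_nbr_fst n M hu hI hi hi' (by omega) (by omega) hq 1 (Or.inl rfl)
  have h2 := Um_nbr_fst n M hu hI hi hi' (by omega) (by omega) hq (-1) (Or.inr rfl)
  have h3 := Um_nbr_snd n M hu hI (by omega) (by omega) hj hj' hq 1 (Or.inl rfl)
  have h4 := Um_nbr_snd n M hu hI (by omega) (by omega) hj hj' hq (-1) (Or.inr rfl)
  rw [← sub_eq_add_neg] at h2 h4
  refine ⟨?_, ?_, ?_⟩
  · rw [d1, d1, h0, h1, h2]
  · rw [d2, d2, h0, h3, h4]
  · rw [lap, lap, h0, h1, h2, h3, h4]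

/-- **the bonds of the masked field are at most those of the pull-back** (horizontal), on the window. [folklore] -/
theorem hb_Um_le (hu : ∀ x, ¬ blockReg n M S x → u x = 0) (hI : IsolatedAt M S σ b a y) {i j : ℤ}
    (hi : -(n : ℤ) + 1 ≤ i) (hi' : i + 2 < n) (hj : -(n : ℤ) ≤ j) (hj' : j < n) :
    hb (Um n M σ b a y u) i j ≤ hb (Up n M σ b u) i j := by
  rw [hb, hb]
  by_cases hq : Quad a y i j
  · rw [Um_self n M hq, Um_nbr_fst n M hu hI hi (by omega) hj hj' hq 1 (Or.inl rfl)]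
  · rw [Um_of_not n M (u := u) (σ := σ) (b := b) hq, sub_zero]
    by_cases hq' : Quad a y (i + 1) j
    · rw [Um_self n M hq']
      -- `(i, j) = (i+1, j) + (−1)` is a first-axis neighbour of the piece site `(i+1, j)` outside the piece ⇒ `Up u (i, j) = 0`
      have h := Um_nbr_fst n M hu hI (i := i + 1) (by omega) (by omega) hj hj' hq' (-1) (Or.inr rfl)
      rw [show i + 1 + -1 = i by ring, Um_of_not n M (u := u) (σ := σ) (b := b) hq] at h
      rw [← h, sub_zero]
    · rw [Um_of_not n M (u := u) (σ := σ) (b := b) hq', norm_zero, zero_pow two_ne_zero]; positivity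

/-- vertical. [folklore] -/
theorem vb_Um_le (hu : ∀ x, ¬ blockReg n M S x → u x = 0) (hI : IsolatedAt M S σ b a y) {i j : ℤ}
    (hi : -(n : ℤ) ≤ i) (hi' : i < n) (hj : -(n : ℤ) + 1 ≤ j) (hj' : j + 2 < n) :
    vb (Um n M σ b a y u) i j ≤ vb (Up n M σ b u) i j := by
  rw [vb, vb]
  by_cases hq : Quad a y i j
  · rw [Um_self n M hq, Um_nbr_snd n M hu hI hi hi' hj (by omega) hq 1 (Or.inl rfl)]
  · rw [Um_of_not n M (u := u) (σ := σ) (b := b) hq, sub_zero]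
    by_cases hq' : Quad a y i (j + 1)
    · rw [Um_self n M hq']
      have h := Um_nbr_snd n M hu hI hi hi' (j := j + 1) (by omega) (by omega) hq' (-1) (Or.inr rfl)
      rw [show j + 1 + -1 = j by ring, Um_of_not n M (u := u) (σ := σ) (b := b) hq] at h
      rw [← h, sub_zero]
    · rw [Um_of_not n M (u := u) (σ := σ) (b := b) hq', norm_zero, zero_pow two_ne_zero]; positivity

omit [NeZero n] hM in
/-- `‖Um‖ ≤ ‖Up‖` pointwise. [folklore] -/
theorem normSq_Um_le (i j : ℤ) : ‖Um n M σ b a y u i j‖ ^ 2 ≤ ‖Up n M σ b u i j‖ ^ 2 := by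
  rw [Um]; split_ifs
  · exact le_rfl
  · rw [norm_zero, zero_pow two_ne_zero]; positivity

/-! ## §2 The local Hessian on the piece -/

/-- **THE LOCAL HESSIAN OF THE PULL-BACK ON AN ISOLATED QUADRANT PIECE** (lattice units): for `u` vanishing off `Ω`, `1 ≤ L`,
`4L + c + 3 ≤ n`, `2 ≤ M_ν`:
`Σ_{Q_{2L+c−1}} 𝟙_{Q(a,y)}(|d1 Up u|²+|d2 Up u|²) ≤ 2·(Σ_{x∈Ω}|Δu|²)/n⁴ + (32/L²)(‖∂₀u‖²+‖∂₁u‖²)/n² + (16/L⁴)·nsq u`. [folklore] -/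
theorem piece_local_hessian_le [DecidablePred S] (hu : ∀ x, ¬ blockReg n M S x → u x = 0) (hI : IsolatedAt M S σ b a y)
    {L c : ℕ} (hL : 1 ≤ L) (hK : 4 * L + c + 3 ≤ n) (hM0 : 2 ≤ M 0) (hM1 : 2 ≤ M 1) :
    sqSum (fun i j => indW (Quad a y) i j * (‖d1 (Up n M σ b u) i j‖ ^ 2 + ‖d2 (Up n M σ b u) i j‖ ^ 2)) (2 * L + c - 1)
      ≤ 2 * ((∑ x ∈ univ.filter (blockReg n M S), ‖(LapS (fine n M) (n : ℂ) *ᵥ u) x‖ ^ 2) / (n : ℝ) ^ 4)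
        + 32 / (L : ℝ) ^ 2 * ((nsq (sdiff (fine n M) (n : ℂ) 0 *ᵥ u) + nsq (sdiff (fine n M) (n : ℂ) 1 *ᵥ u)) / (n : ℝ) ^ 2)
        + 16 / (L : ℝ) ^ 4 * nsq u := by
  set K : ℕ := 4 * L + c + 1 with hKdef
  have hKn : K + 2 ≤ n := by omega
  have hn0 : (0 : ℝ) < n := by exact_mod_cast Nat.pos_of_ne_zero (NeZero.ne n)
  have hn4 : (0 : ℝ) < (n : ℝ) ^ 4 := by positivity
  have hW0 : 2 * K + 2 ≤ n * M 0 := by have := Nat.mul_le_mul_left n hM0; omega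
  have hW1 : 2 * K + 2 ≤ n * M 1 := by have := Nat.mul_le_mul_left n hM1; omega
  set U : ℤ → ℤ → ℂ := Um n M σ b a y u with hU
  set G : ℤ → ℤ → ℂ := fun i j => (LapS (fine n M) (n : ℂ) *ᵥ u) (emb n M σ b i j) / (n : ℂ) ^ 2 with hG
  -- hypotheses of the model brick
  have hUW : ∀ i j : ℤ, tIdx i ≤ 4 * (L : ℤ) + c → tIdx j ≤ 4 * (L : ℤ) + c → ¬ Quad a y i j → U i j = 0 := by
    intro i j _ _ hq; rw [hU, Um, if_neg hq]
  have hEq : ∀ i j : ℤ, tIdx i ≤ 4 * (L : ℤ) + c + 1 → tIdx j ≤ 4 * (L : ℤ) + c + 1 → Quad a y i j → lap U i j = G i j := by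
    intro i j hi hj hq
    have hi' : -(n : ℤ) + 1 ≤ i ∧ i + 1 < n := by unfold tIdx at hi; split_ifs at hi <;> constructor <;> omega
    have hj' : -(n : ℤ) + 1 ≤ j ∧ j + 1 < n := by unfold tIdx at hj; split_ifs at hj <;> constructor <;> omega
    have hn2 : (n : ℂ) ^ 2 ≠ 0 := pow_ne_zero 2 (by exact_mod_cast NeZero.ne n)
    show lap U i j = (LapS (fine n M) (n : ℂ) *ᵥ u) (emb n M σ b i j) / (n : ℂ) ^ 2
    rw [hU, (hess_Um_eq n M hu hI hi'.1 hi'.2 hj'.1 hj'.2 hq).2.2, LapS_emb, mul_div_cancel_left₀ _ hn2]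
  have hloc := local_hessian_le_shift (Quad a y) U hL (axisSep_Wprod _ _) G hUW hEq
  -- LHS: on the plateau the masked Hessian is the pull-back's Hessian at piece sites
  have hlhs : sqSum (fun i j => indW (Quad a y) i j * (‖d1 (Up n M σ b u) i j‖ ^ 2 + ‖d2 (Up n M σ b u) i j‖ ^ 2)) (2 * L + c - 1)
      = sqSum (fun i j => indW (Quad a y) i j * (‖d1 U i j‖ ^ 2 + ‖d2 U i j‖ ^ 2)) (2 * L + c - 1) := by
    refine sum_congr rfl fun t ht => sum_congr rfl fun s hs => ?_
    have ht' := mem_range.mp ht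
    have hs' := mem_range.mp hs
    dsimp only
    unfold indW
    split_ifs with hq
    · obtain ⟨e1, e2, -⟩ := hess_Um_eq n M hu hI (i := -((2 * L + c - 1 : ℕ) : ℤ) + s) (j := -((2 * L + c - 1 : ℕ) : ℤ) + t)
        (by omega) (by omega) (by omega) (by omega) hq
      rw [e1, e2]
    · rw [zero_mul, zero_mul]
  rw [hlhs]
  -- the three window quantities
  have hSG : sqSum (fun i j => indW (Quad a y) i j * ‖G i j‖ ^ 2) K
      ≤ (∑ x ∈ univ.filter (blockReg n M S), ‖(LapS (fine n M) (n : ℂ) *ᵥ u) x‖ ^ 2) / (n : ℝ) ^ 4 := by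
    set P : Tor (fine n M) → ℝ := fun x => if blockReg n M S x then ‖(LapS (fine n M) (n : ℂ) *ᵥ u) x‖ ^ 2 else 0 with hP
    have hP0 : ∀ x, 0 ≤ P x := fun x => by rw [hP]; simp only; split_ifs <;> positivity
    have e : ∀ x, ‖(LapS (fine n M) (n : ℂ) *ᵥ u) x / (n : ℂ) ^ 2‖ ^ 2 = ‖(LapS (fine n M) (n : ℂ) *ᵥ u) x‖ ^ 2 / (n : ℝ) ^ 4 := by
      intro x; rw [norm_div, div_pow, norm_pow, Complex.norm_natCast, ← pow_mul]
    have hterm : ∀ t ∈ range (2 * K), ∀ s ∈ range (2 * K),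
        indW (Quad a y) (-(K : ℤ) + s) (-(K : ℤ) + t) * ‖G (-(K : ℤ) + s) (-(K : ℤ) + t)‖ ^ 2
          ≤ P (emb n M σ b (-(K : ℤ) + s) (-(K : ℤ) + t)) / (n : ℝ) ^ 4 := by
      intro t ht s hs
      simp only [mem_range] at ht hs
      rw [indW, hP, hG]
      simp only
      split_ifs with hq hΩ hΩ
      · rw [one_mul, e]
      · exact absurd (blockReg_of_quad n M hI (by omega) (by omega) (by omega) (by omega) hq) hΩ
      · rw [zero_mul]; positivity
      · rw [zero_mul]; positivity
    calc sqSum (fun i j => indW (Quad a y) i j * ‖G i j‖ ^ 2) K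
        ≤ ∑ t ∈ range (2 * K), ∑ s ∈ range (2 * K), P (emb n M σ b (-(K : ℤ) + s) (-(K : ℤ) + t)) / (n : ℝ) ^ 4 :=
          sum_le_sum fun t ht => sum_le_sum fun s hs => hterm t ht s hs
      _ = (∑ t ∈ range (2 * K), ∑ s ∈ range (2 * K), P (emb n M σ b (-(K : ℤ) + s) (-(K : ℤ) + t))) / (n : ℝ) ^ 4 := by
          simp only [sum_div]
      _ ≤ (∑ x, P x) / (n : ℝ) ^ 4 := by
          refine div_le_div_of_nonneg_right ?_ hn4.le
          refine sum_sum_le_univ_of_injOn n M (fun t s => emb n M σ b (-(K : ℤ) + s) (-(K : ℤ) + t)) P hP0 ?_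
          intro t ht s hs t' ht' s' hs' h
          simp only [mem_range] at ht hs ht' hs'
          have := emb_injOn n M (σ := σ) (b := b) (a₀ := -(K : ℤ)) (a₁ := -(K : ℤ)) (W₀ := 2 * K) (W₁ := 2 * K) (by omega) (by omega)
            (i := -(K : ℤ) + s) (j := -(K : ℤ) + t) (i' := -(K : ℤ) + s') (j' := -(K : ℤ) + t')
            (by omega) (by omega) (by omega) (by omega) (by omega) (by omega) (by omega) (by omega) h
          omega
      _ = _ := by rw [hP, sum_filter]
  have hEt : Et U K ≤ (nsq (sdiff (fine n M) (n : ℂ) 0 *ᵥ u) + nsq (sdiff (fine n M) (n : ℂ) 1 *ᵥ u)) / (n : ℝ) ^ 2 := by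
    have hH : EtH U K ≤ EtH (Up n M σ b u) K := by
      rw [EtH, EtH]
      refine sum_le_sum fun t ht => sum_le_sum fun s hs => ?_
      simp only [mem_range] at ht hs
      exact hb_Um_le n M hu hI (by omega) (by omega) (by omega) (by omega)
    have hV : EtV U K ≤ EtV (Up n M σ b u) K := by
      rw [EtV, EtV]
      refine sum_le_sum fun s hs => sum_le_sum fun t ht => ?_
      simp only [mem_range] at ht hs
      exact vb_Um_le n M hu hI (by omega) (by omega) (by omega) (by omega)
    rw [Et_eq_rect, add_div]
    exact add_le_add (hH.trans (EtH_Up_le n M σ b u hW0 (by omega))) (hV.trans (EtV_Up_le n M σ b u (by omega) hW1))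
  have hS : sqSum (fun i j => ‖U i j‖ ^ 2) K ≤ nsq u :=
    (DirichletRingHessianWindow.sqSum_le_of_le (fun i j => normSq_Um_le n M i j) K).trans (sqSum_normSq_Up_le n M u (by omega) (by omega))
  refine hloc.trans ?_
  gcongr

/-! ## §3 The push-forward and the torus bound -/

/-- the PUSHED-FORWARD PIECE INDICATOR on the plateau `Q_P`. [folklore] -/
def pieceW (v : (Fin 2 → Bool) × Tor M) (a y : Bool) (P : ℕ) (x : Tor (fine n M)) : ℝ :=
  ∑ t ∈ range (2 * P), ∑ s ∈ range (2 * P),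
    if x = emb n M v.1 v.2 (-(P : ℤ) + s) (-(P : ℤ) + t) then indW (Quad a y) (-(P : ℤ) + s) (-(P : ℤ) + t) else 0

omit [NeZero n] hM in
/-- `0 ≤ pieceW`. [folklore] -/
theorem pieceW_nonneg (v : (Fin 2 → Bool) × Tor M) (a y : Bool) (P : ℕ) (x : Tor (fine n M)) : 0 ≤ pieceW n M v a y P x := by
  refine sum_nonneg fun t _ => sum_nonneg fun s _ => ?_
  split_ifs
  · exact (indW_mem _ _ _).1
  · exact le_rfl

/-- **EXCHANGE OF SUMS** for `pieceW`. [folklore] -/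
theorem sum_pieceW_mul (v : (Fin 2 → Bool) × Tor M) (a y : Bool) (P : ℕ) (F : Tor (fine n M) → ℝ) :
    ∑ x, pieceW n M v a y P x * F x
      = ∑ t ∈ range (2 * P), ∑ s ∈ range (2 * P),
          indW (Quad a y) (-(P : ℤ) + s) (-(P : ℤ) + t) * F (emb n M v.1 v.2 (-(P : ℤ) + s) (-(P : ℤ) + t)) := by
  simp only [pieceW, sum_mul]
  rw [sum_comm]
  refine sum_congr rfl fun t _ => ?_
  rw [sum_comm]
  refine sum_congr rfl fun s _ => ?_
  simp only [ite_mul, zero_mul, sum_ite_eq', mem_univ, if_true]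

/-- **THE UNWEIGHTED HESSIAN CHARGED TO AN ISOLATED QUADRANT PIECE**: for `u` vanishing off `Ω`, `1 ≤ L`, `4L + c + 3 ≤ n`, `2 ≤ M_ν`,
plateau `P = 2L + c − 1`:
`Σ_μ Σ_x pieceW(x)·|(∂ᴴ_μ∂_μ u)(x)|² ≤ 2·Σ_{x∈Ω}|Δu|² + 32(n/L)²(‖∂₀u‖²+‖∂₁u‖²) + 16(n/L)⁴·nsq u`. [folklore] -/
theorem piece_hessian_le [DecidablePred S] (hu : ∀ x, ¬ blockReg n M S x → u x = 0) (hI : IsolatedAt M S σ b a y)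
    {L c : ℕ} (hL : 1 ≤ L) (hK : 4 * L + c + 3 ≤ n) (hM0 : 2 ≤ M 0) (hM1 : 2 ≤ M 1) :
    ∑ μ, ∑ x, pieceW n M (σ, b) a y (2 * L + c - 1) x * ‖(Pdir (fine n M) (n : ℂ) μ *ᵥ u) x‖ ^ 2
      ≤ 2 * ∑ x ∈ univ.filter (blockReg n M S), ‖(LapS (fine n M) (n : ℂ) *ᵥ u) x‖ ^ 2
        + 32 * ((n : ℝ) / L) ^ 2 * (nsq (sdiff (fine n M) (n : ℂ) 0 *ᵥ u) + nsq (sdiff (fine n M) (n : ℂ) 1 *ᵥ u))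
        + 16 * ((n : ℝ) / L) ^ 4 * nsq u := by
  set P : ℕ := 2 * L + c - 1 with hP
  have hn0 : (0 : ℝ) < n := by exact_mod_cast Nat.pos_of_ne_zero (NeZero.ne n)
  have hL0 : (0 : ℝ) < L := by exact_mod_cast hL
  have hloc := piece_local_hessian_le n M hu hI hL hK hM0 hM1
  have step1 : ∑ μ, ∑ x, pieceW n M (σ, b) a y P x * ‖(Pdir (fine n M) (n : ℂ) μ *ᵥ u) x‖ ^ 2
      = (n : ℝ) ^ 4 * sqSum (fun i j => indW (Quad a y) i j * (‖d1 (Up n M σ b u) i j‖ ^ 2 + ‖d2 (Up n M σ b u) i j‖ ^ 2)) P := by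
    rw [Fin.sum_univ_two, sum_pieceW_mul, sum_pieceW_mul, ← sum_add_distrib, sqSum, mul_sum]
    refine sum_congr rfl fun t _ => ?_
    rw [← sum_add_distrib, mul_sum]
    refine sum_congr rfl fun s _ => ?_
    rw [Pdir_emb_fst, Pdir_emb_snd, norm_mul, norm_mul, norm_neg, norm_pow, Complex.norm_natCast, mul_pow, mul_pow, ← pow_mul]
    ring
  rw [step1]
  have e : (n : ℝ) ^ 4 * (2 * ((∑ x ∈ univ.filter (blockReg n M S), ‖(LapS (fine n M) (n : ℂ) *ᵥ u) x‖ ^ 2) / (n : ℝ) ^ 4)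
        + 32 / (L : ℝ) ^ 2 * ((nsq (sdiff (fine n M) (n : ℂ) 0 *ᵥ u) + nsq (sdiff (fine n M) (n : ℂ) 1 *ᵥ u)) / (n : ℝ) ^ 2)
        + 16 / (L : ℝ) ^ 4 * nsq u)
      = 2 * ∑ x ∈ univ.filter (blockReg n M S), ‖(LapS (fine n M) (n : ℂ) *ᵥ u) x‖ ^ 2
        + 32 * ((n : ℝ) / L) ^ 2 * (nsq (sdiff (fine n M) (n : ℂ) 0 *ᵥ u) + nsq (sdiff (fine n M) (n : ℂ) 1 *ᵥ u))
        + 16 * ((n : ℝ) / L) ^ 4 * nsq u := by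
    field_simp
  rw [← e]
  exact mul_le_mul_of_nonneg_left hloc (by positivity)

variable (S) (a' : ℝ)

/-- **THE UNWEIGHTED HESSIAN OF THE DIRICHLET SOLUTION CHARGED TO AN ISOLATED QUADRANT PIECE**: for `u = solExt n M a′ Ω f`,
`Σ_μ Σ_x pieceW(x)·|(∂ᴴ_μ∂_μ u)(x)|² ≤ (4(1+(a′γ′⁻¹)²) + 32(n/L)²γ′⁻¹ + 16(n/L)⁴γ′⁻²)·‖f‖²`. [folklore] -/
theorem piece_hessian_solExt_le [DecidablePred S] (hI : IsolatedAt M S σ b a y)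
    {L c : ℕ} (hL : 1 ≤ L) (hK : 4 * L + c + 3 ≤ n) (hM0 : 2 ≤ M 0) (hM1 : 2 ≤ M 1) (ha' : 0 < a')
    (f : {y // blockReg n M S y} → ℂ) :
    ∑ μ, ∑ x, pieceW n M (σ, b) a y (2 * L + c - 1) x * ‖(Pdir (fine n M) (n : ℂ) μ *ᵥ solExt n M a' (blockReg n M S) f) x‖ ^ 2
      ≤ (4 * (1 + (a' * (gammaPs 2 a')⁻¹) ^ 2) + 32 * ((n : ℝ) / L) ^ 2 * (gammaPs 2 a')⁻¹
          + 16 * ((n : ℝ) / L) ^ 4 * ((gammaPs 2 a')⁻¹) ^ 2) * nsq f := by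
  set u := solExt n M a' (blockReg n M S) f with hu
  have hu0 : ∀ x, ¬ blockReg n M S x → u x = 0 := fun x hx => solExt_apply_of_not n M a' _ f hx
  have hγp := (gammaPs_pos (d := 2) (a' := a')).1
  have hE : nsq (sdiff (fine n M) (n : ℂ) 0 *ᵥ u) + nsq (sdiff (fine n M) (n : ℂ) 1 *ᵥ u) ≤ (gammaPs 2 a')⁻¹ * nsq f := by
    have h := dirichlet_solExt_le n M a' (blockReg n M S) ha' f
    rw [dirichlet, Fin.sum_univ_two] at h
    exact h
  have hB : ∑ x ∈ univ.filter (blockReg n M S), ‖(LapS (fine n M) (n : ℂ) *ᵥ u) x‖ ^ 2 ≤ 2 * (1 + (a' * (gammaPs 2 a')⁻¹) ^ 2) * nsq f := by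
    rw [Finset.sum_subtype (univ.filter (blockReg n M S)) (p := blockReg n M S) (fun x => by simp)
      (fun x => ‖(LapS (fine n M) (n : ℂ) *ᵥ u) x‖ ^ 2)]
    exact sum_normSq_LapS_solExt_le n M a' (blockReg n M S) ha' f
  have hN : nsq u ≤ ((gammaPs 2 a')⁻¹) ^ 2 * nsq f := nsq_solExt_le n M a' (blockReg n M S) ha' f
  have hf0 := nsq_nonneg f
  have h := piece_hessian_le n M (σ := σ) (b := b) (a := a) (y := y) hu0 hI hL hK hM0 hM1
  refine h.trans ?_
  have hn0 : (0 : ℝ) ≤ ((n : ℝ) / L) ^ 2 := sq_nonneg _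
  have hn4 : (0 : ℝ) ≤ ((n : ℝ) / L) ^ 4 := by positivity
  nlinarith [mul_le_mul_of_nonneg_left hE (by positivity : (0 : ℝ) ≤ 32 * ((n : ℝ) / L) ^ 2),
    mul_le_mul_of_nonneg_left hN (by positivity : (0 : ℝ) ≤ 16 * ((n : ℝ) / L) ^ 4)]

end Piece

end Summit.QuantumFields.BalabanUV.Beta.GAN24.DirichletVertexPiece

end
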